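import Literature.NumberTheory.Weil1964.ArchWeilDatumFactorisation
import Literature.Analysis.Distribution.SchwartzExternalProduct
import HarnessLib

/-!
# The archimedean factorisation in intertwined form: `A b (τ (Φ₁ ⊠ Φ₂)) = τ (((χ ⊗ ω₁)(u b) Φ₁) ⊠ Φ₂)`

Topic `NumberTheory/Weil1964`; namespace `Literature.NumberTheory.Weil1964`.  Origin: `pub-hodgecm`
MODEL-CONSTRUCTION sub-cell, theta lane (seat mc-theta-3 gen 6), item (T-j) «the archimedean factorisation of
ω_∞ at the harmonic vectors», consumer step.  KERNEL MATHEMATICS ONLY: everything below is proved; no record,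
no cited hypothesis.

`ArchWeilDatumFactorisation` proves: for an archimedean Weil datum `ω` of `G` on `𝓢(ℝ^{σ₁ ⊕ σ₂})`, one `ω₁`
of `G₁` on `𝓢(ℝ^{σ₁})`, both with continuous operators, and a continuous `s : G₁ →* G` along which the
symplectic image is block-diagonal with identity second block, `ω (s u) (Φ₁ ⊠ Φ₂) = (ω₁' u Φ₁) ⊠ Φ₂` for a
twisted datum `ω₁'` (`IsArchWeilDatum.exists_twist_factorisation`, [Folland 1989, Prop. (1.43), §4.2 (4.23)]).
Consumers need three refinements, recorded here once:

* § 1 `SchwartzMap.sumProdLeftCLM Φ₂ Φ₁ = Φ₁ ⊠ Φ₂` (`sumProdLeftCLM_apply_eq_tensorPi`, and the `Right`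
  variant): the external product AS A CONTINUOUS LINEAR MAP of one factor
  (`Analysis/Distribution/SchwartzExternalProduct`) is the tree's `tensorPi`
  (`Analysis/SegalBargmann/SchwartzTensorPi`) — pointwise `rfl`; hence `tensorPi` is continuous in each factor.
* § 2 **`IsArchWeilDatum.exists_circle_twist_factorisation`** — the headline with the twist made EXPLICIT:
  `ω₁' = χ ⊗ ω₁ := charTwist (Circle.coeHom ∘ χ) ω₁` for a CONTINUOUS CIRCLE-VALUED character `χ : G₁ →* Circle`
  (the factor character `IsBlockPair.factorCharCircle`).  Consumers that differentiate matrix coefficients need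
  `ω₁`, its vacuum line and `χ` separately (a continuous character of a Lie group is smooth), not only `ω₁'`.
* § 3 **`IsArchWeilDatum.exists_circle_twist_factorisation_map`** (+ `_clm`) — THE INTERTWINED FORM: if a family
  of operators `A b` on another `ℂ`-module `F` is reached from `ω ∘ s ∘ u` through a linear
  `τ : 𝓢(ℝ^{σ₁ ⊕ σ₂}) →ₗ F`, `A b (τ x) = τ (ω (s (u b)) x)`, then along `L := τ ∘ (· ⊠ Φ₂)` one has
  `A b (L Φ₁) = L ((χ ⊗ ω₁)(u b) Φ₁)` — the hypothesis shape under which smoothness / annihilation statements for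
  the small twisted datum transport to `A` along `L` (e.g. `KonnoKonno2007/JunctionPMinusBallFrame` § 4,
  `KonnoKonno2007/JunctionCharacterSmooth`).

References (provenance of the factorisation; nothing here is cited as a hypothesis):
* G. B. Folland, *Harmonic Analysis in Phase Space*, Princeton UP (1989), Prop. (1.43), §4.2 (4.23).
* A. Weil, *Sur certains groupes d'opérateurs unitaires*, Acta Math. 111 (1964), n° 37–38.
-/

set_option autoImplicit false

noncomputable section

open MeasureTheory Complex SchwartzMap

namespace Literature.NumberTheory.Weil1964

open Literature.Analysis.SegalBargmann Literature.RepresentationTheory.HeisenbergGroup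
open Literature.Analysis.Distribution

/-! ## §1 The external product CLM of `SchwartzExternalProduct` is `tensorPi` -/

section TensorCLM

variable {σ₁ σ₂ : Type*} [Fintype σ₁] [Fintype σ₂]

/-- `sumProdLeftCLM Φ₂ Φ₁ = Φ₁ ⊠ Φ₂` (pointwise `rfl`). [folklore] -/
@[simp] theorem sumProdLeftCLM_apply_eq_tensorPi (Φ₂ : SchwartzMap (σ₂ → ℝ) ℂ)
    (Φ₁ : SchwartzMap (σ₁ → ℝ) ℂ) : SchwartzMap.sumProdLeftCLM Φ₂ Φ₁ = tensorPi Φ₁ Φ₂ := by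
  ext x; rfl

/-- `sumProdRightCLM Φ₁ Φ₂ = Φ₁ ⊠ Φ₂` (pointwise `rfl`). [folklore] -/
@[simp] theorem sumProdRightCLM_apply_eq_tensorPi (Φ₁ : SchwartzMap (σ₁ → ℝ) ℂ)
    (Φ₂ : SchwartzMap (σ₂ → ℝ) ℂ) : SchwartzMap.sumProdRightCLM Φ₁ Φ₂ = tensorPi Φ₁ Φ₂ := by
  ext x; rfl

/-- hence `Φ₁ ↦ Φ₁ ⊠ Φ₂` is continuous. [folklore] -/
theorem continuous_tensorPi_left (Φ₂ : SchwartzMap (σ₂ → ℝ) ℂ) :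
    Continuous fun Φ₁ : SchwartzMap (σ₁ → ℝ) ℂ => tensorPi Φ₁ Φ₂ := by
  have h := (SchwartzMap.sumProdLeftCLM (𝕜 := ℂ) (E := ℝ) (ι₁ := σ₁) Φ₂).continuous
  refine h.congr fun Φ₁ => ?_
  exact sumProdLeftCLM_apply_eq_tensorPi Φ₂ Φ₁

/-- and `Φ₂ ↦ Φ₁ ⊠ Φ₂` is continuous. [folklore] -/
theorem continuous_tensorPi_right (Φ₁ : SchwartzMap (σ₁ → ℝ) ℂ) :
    Continuous fun Φ₂ : SchwartzMap (σ₂ → ℝ) ℂ => tensorPi Φ₁ Φ₂ := by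
  have h := (SchwartzMap.sumProdRightCLM (𝕜 := ℂ) (E := ℝ) (ι₂ := σ₂) Φ₁).continuous
  refine h.congr fun Φ₂ => ?_
  exact sumProdRightCLM_apply_eq_tensorPi Φ₁ Φ₂

end TensorCLM

/-! ## §2 The factorisation with an explicit continuous circle character -/

section WeilData

variable {σ₁ σ₂ : Type*} [Fintype σ₁] [Fintype σ₂] [DecidableEq σ₁] [DecidableEq σ₂]
variable {G₁ G : Type*} [Group G₁] [Group G] [TopologicalSpace G₁] [TopologicalSpace G]

/- The standing hypotheses of `IsArchWeilDatum.exists_twist_factorisation`: a big datum `ω` over `ι𝕎`, a small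
one `ω₁` over `ι𝕎₁`, both with continuous operators, and a continuous `s : G₁ →* G` along which `ι𝕎 ∘ s` is
block-diagonal with blocks `(ι𝕎₁ u, 1)`. -/
variable {ι𝕎 : G →* symplecticGroup (polar (dotPairing (σ₁ ⊕ σ₂)))}
  {ω : Representation ℂ G (SchwartzMap (σ₁ ⊕ σ₂ → ℝ) ℂ)} (hW : IsArchWeilDatum ι𝕎 ω)
  (hc : ∀ g, Continuous (ω g))
  {ι𝕎₁ : G₁ →* symplecticGroup (polar (dotPairing σ₁))} {ω₁ : Representation ℂ G₁ (SchwartzMap (σ₁ → ℝ) ℂ)}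
  (hW₁ : IsArchWeilDatum ι𝕎₁ ω₁) (hc₁ : ∀ u, Continuous (ω₁ u)) (s : G₁ →* G) (hs_cont : Continuous s)
  (hs : ∀ u,
    (⇑((ι𝕎 (s u)).1 : ((σ₁ ⊕ σ₂ → ℝ) × (σ₁ ⊕ σ₂ → ℝ)) ≃ₗ[ℝ] (σ₁ ⊕ σ₂ → ℝ) × (σ₁ ⊕ σ₂ → ℝ)) :
        PhaseMap (σ₁ ⊕ σ₂)) =
      blockPhase (⇑((ι𝕎₁ u).1 : ((σ₁ → ℝ) × (σ₁ → ℝ)) ≃ₗ[ℝ] (σ₁ → ℝ) × (σ₁ → ℝ))) id)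

include hW hc hW₁ hc₁ hs_cont hs

/-- **The archimedean factorisation at product vectors, twist explicit**: under the hypotheses of
`IsArchWeilDatum.exists_twist_factorisation` there is a CONTINUOUS character `χ : G₁ →* Circle` (the factor
character) with `ω (s u) (Φ₁ ⊠ Φ₂) = ((χ ⊗ ω₁) u Φ₁) ⊠ Φ₂` for all `u, Φ₁, Φ₂`, where
`χ ⊗ ω₁ = charTwist (Circle.coeHom ∘ χ) ω₁` (again an archimedean Weil datum over `ι𝕎₁`: `IsArchWeilDatum.twist`).
[cite: Folland1989, Prop. (1.43), §4.2 (4.23)] -/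
theorem IsArchWeilDatum.exists_circle_twist_factorisation :
    ∃ χ : G₁ →* Circle, Continuous χ ∧
      ∀ (u : G₁) (Φ₁ : SchwartzMap (σ₁ → ℝ) ℂ) (Φ₂ : SchwartzMap (σ₂ → ℝ) ℂ),
        ω (s u) (tensorPi Φ₁ Φ₂) = tensorPi (charTwist (Circle.coeHom.comp χ) ω₁ u Φ₁) Φ₂ := by
  have h := hW.isBlockPair hc hW₁ hc₁ s hs
  have hl : ∀ u, ∃ U : (Lp ℂ 2 (volume : Measure (σ₁ ⊕ σ₂ → ℝ))) ≃ₗᵢ[ℂ]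
      Lp ℂ 2 (volume : Measure (σ₁ ⊕ σ₂ → ℝ)), LiftsTo (ω (s u))
      ((U.toContinuousLinearEquiv :
          (Lp ℂ 2 (volume : Measure (σ₁ ⊕ σ₂ → ℝ))) ≃L[ℂ] Lp ℂ 2 (volume : Measure (σ₁ ⊕ σ₂ → ℝ))) :
        (Lp ℂ 2 (volume : Measure (σ₁ ⊕ σ₂ → ℝ))) →L[ℂ] Lp ℂ 2 (volume : Measure (σ₁ ⊕ σ₂ → ℝ))) :=
    fun u => hW.exists_lift (s u)
  refine ⟨h.factorCharCircle hl hW₁.exists_lift,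
    Continuous.subtype_mk (h.continuous_factorChar hs_cont hW.continuous_apply hW₁.continuous_apply) _,
    fun u Φ₁ Φ₂ => ?_⟩
  rw [h.coeHom_comp_factorCharCircle]
  exact h.apply_tensorPi_eq_twist u Φ₁ Φ₂

/-! ## §3 The intertwined form -/

/-- **THE FACTORISATION THROUGH AN INTERTWINER.**  If operators `A b` (`b : P'`) on a `ℂ`-module `F` satisfy
`A b (τ x) = τ (ω (s (u b)) x)` for a `ℂ`-linear `τ : 𝓢(ℝ^{σ₁ ⊕ σ₂}) →ₗ F` and `u : P' → G₁`, then
`A b (τ (Φ₁ ⊠ Φ₂)) = τ (((χ ⊗ ω₁)(u b) Φ₁) ⊠ Φ₂)` with the continuous circle character `χ` of § 2.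
[cite: Folland1989, Prop. (1.43), §4.2 (4.23)] -/
theorem IsArchWeilDatum.exists_circle_twist_factorisation_map {F : Type*} [AddCommGroup F] [Module ℂ F]
    {P' : Type*} (τ : SchwartzMap (σ₁ ⊕ σ₂ → ℝ) ℂ →ₗ[ℂ] F) (A : P' → F →ₗ[ℂ] F) (u : P' → G₁)
    (hA : ∀ (b : P') (x : SchwartzMap (σ₁ ⊕ σ₂ → ℝ) ℂ), A b (τ x) = τ (ω (s (u b)) x)) :
    ∃ χ : G₁ →* Circle, Continuous χ ∧
      ∀ (b : P') (Φ₁ : SchwartzMap (σ₁ → ℝ) ℂ) (Φ₂ : SchwartzMap (σ₂ → ℝ) ℂ),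
        A b (τ (tensorPi Φ₁ Φ₂)) = τ (tensorPi (charTwist (Circle.coeHom.comp χ) ω₁ (u b) Φ₁) Φ₂) := by
  obtain ⟨χ, hχ, hfac⟩ := hW.exists_circle_twist_factorisation hc hW₁ hc₁ s hs_cont hs
  exact ⟨χ, hχ, fun b Φ₁ Φ₂ => by rw [hA, hfac]⟩

/-- **The intertwined form along the continuous linear map `L := τ ∘L (· ⊠ Φ₂)`**:
`A b (L Φ₁) = L ((χ ⊗ ω₁)(u b) Φ₁)` — the `hω` hypothesis shape of the junction transport lemmas.
[cite: Folland1989, Prop. (1.43), §4.2 (4.23)] -/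
theorem IsArchWeilDatum.exists_circle_twist_factorisation_clm {F : Type*} [AddCommGroup F] [Module ℂ F]
    [TopologicalSpace F] {P' : Type*} (τ : SchwartzMap (σ₁ ⊕ σ₂ → ℝ) ℂ →L[ℂ] F) (A : P' → F →ₗ[ℂ] F)
    (u : P' → G₁) (hA : ∀ (b : P') (x : SchwartzMap (σ₁ ⊕ σ₂ → ℝ) ℂ), A b (τ x) = τ (ω (s (u b)) x))
    (Φ₂ : SchwartzMap (σ₂ → ℝ) ℂ) :
    ∃ χ : G₁ →* Circle, Continuous χ ∧
      ∀ (b : P') (Φ₁ : SchwartzMap (σ₁ → ℝ) ℂ),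
        A b (τ.comp (SchwartzMap.sumProdLeftCLM Φ₂) Φ₁) =
          τ.comp (SchwartzMap.sumProdLeftCLM Φ₂) (charTwist (Circle.coeHom.comp χ) ω₁ (u b) Φ₁) := by
  obtain ⟨χ, hχ, hfac⟩ := hW.exists_circle_twist_factorisation_map hc hW₁ hc₁ s hs_cont hs
    (τ : SchwartzMap (σ₁ ⊕ σ₂ → ℝ) ℂ →ₗ[ℂ] F) A u hA
  refine ⟨χ, hχ, fun b Φ₁ => ?_⟩
  simp only [sumProdLeftCLM_apply_eq_tensorPi, ContinuousLinearMap.comp_apply]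
  exact hfac b Φ₁ Φ₂

end WeilData

end Literature.NumberTheory.Weil1964

end
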